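import Summits.AtomisticToContinuum.Crystallization.Theorems.FluxTubeKeplerFloorGivesLayered
import Summits.AtomisticToContinuum.Crystallization.Theorems.FluxTubeKeplerFluxCellKeplerSingleScale
import Summits.AtomisticToContinuum.Crystallization.Theorems.ChessboardParticlePlanesPeriodicWindowsIffCrystallization
import Summits.AtomisticToContinuum.Crystallization.Theorems.FluxTubeKeplerKeplerEnergyFloor

/-!
# Line `VacancyBlindRung` (vacancy ladder) — skeleton for the forward rung over `FluxTubeKepler.FloorGivesLayered`
(crux dir `FluxCellKepler`, stmt-AtomisticToContinuum-15221; fwd-rung G1 gen 2, seed g1-AtomisticToContinuum-15223)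

FLOOR (proved, `FluxTubeKeplerFloorGivesLayered.FloorGivesLayered_proof`): for every periodic `P₀`, the energy
floor `N·e(P₀) ≤ E(x)` on Lennard-Jones ground states together with the defect BUDGET pricing, at every scale
`(R,η)`, every site that is not TWO-WAY `(R,η)`-layered (particles → template AND template → particles) forces
layered windows, hence (proved `PeriodicGivenLayered`) periodic windows, along every ground-state sequence.  Its
proof is energy-free counting after Step 1 (`eventually_exists_not_bad`): one good site per scale, then
`spacing_selection` + `match_dilate`, which consume BOTH matching directions.

RUNG (`VacancyBlindRung := VacRung 0`): the budget need only price the sites whose `R`-neighbourhood is not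
`η`-close to a SUBSET of an admissible layered template (one-way matching; vacancies and internal voids inside
layered material are unpriced).  Dial `VacRung κ` (template → particles demanded on the `κR`-ball): `VacRung 1`
is the floor (`vacRung_one`, F3), antitone dial `vacRung_mono`, honest flatness above zero `vacRung_of_pos`,
on-path `vacRung_of_crystallization` / `VacancyBlindRung_of_Crystallization` (F4, landed iff
`periodicWindows_of_crystallization`).

WHY THE FLOOR'S PROOF STOPS: with the one-way budget, Step 1 yields only ONE-WAY-good sites; `match_dilate`'s
template → cloud hypothesis has no input.  Potential-free repair is impossible (a periodic vacancy superlattice of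
spacing `< R` is one-way good everywhere and two-way good nowhere); the missing input is ENERGY: along ground states
`E(x_N) = N·e* + o(N)` (FLOOR + `crysEnergyLimit`), and vacancies adjacent to layered material cost surface energy.

THE LINE (three stubs, the only `sorry`s; composition `VacancyBlindRung_of` sorry-free):
* `stub_voidSurfaceCost` (THE NEW INPUT, energy): at the nearest-neighbour scale `6/5`, one-way-good sites with an
  adjacent vacancy are priced by the excess energy `E − N·e*` up to `ω·N` and the one-way-bad sites — identity
  `E_O = Σ_{p∈O} e_p(T) + ½·B(O, T∖O)` for the occupied subset `O` of ONE template per window (all template bonds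
  attractive: pair distances `≥ 0.9704·a ≥ 0.912 > 2^{-1/6}`), `N·e* ≤ E` for every finite configuration
  (landed `card_mul_eStar_le`, padded periodisation) and layer-cake control of the first-order layer-energy
  variation of non-uniform box templates.
* `stub_vacancySpread` (potential-free): a one-way-good site with an `η'`-vacancy within `R` lies within `R+2` of a
  one-way-good site with a nearest-neighbour vacancy (template path + recentring `T − q` of admissible layered sets +
  the 12-versus-11 first-shell count), so the `R`-scale count is `≤ M(R,δ)` times the `6/5`-scale count
  (`δ`-separation of ground states, ball packing).
* `stub_goodSitesOfVacancyCost` (counting): FLOOR + one-way budget + the vacancy cost inequality ⇒ two-way good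
  sites at every scale frequently (`floor_iff_eq_eStar`, `crysEnergyLimit`, cardinal arithmetic).
Glue: `vacancyCost_of` (stubs 1+2 ⇒ `VacancyCost`), `hasLayeredWindows_of_good` (Steps 2–3 of the seed, verbatim
from the sibling line `Lines/PosTolRung.lean`), proved `PeriodicGivenLayered`.
-/

noncomputable section

namespace Summit.AtomisticToContinuum.Crystallization.Cruxes.FluxCellKepler.VacancyLadder

open scoped BigOperators Classical
open Filter Topology
open Literature.MathematicalPhysics.StatisticalMechanics
open Summit.AtomisticToContinuum.Crystallization.Theorems.FluxCellKeplerSingleScale (LayeredGood layeredGood_mono)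

local notation "E3" => EuclideanSpace ℝ (Fin 3)

/-- FLOOR(P₀): `N · e(P₀) ≤ E(x)` for every Lennard-Jones ground state (verbatim the floor's first hypothesis). -/
def Floor (P₀ : PeriodicConfiguration 3) : Prop :=
  ∀ (N : ℕ) (x : Fin N → E3), IsGroundState lennardJones x →
    (N : ℝ) * P₀.energyPerParticle lennardJones ≤ interactionEnergy lennardJones x

/-- `κ`-GOOD SITE: some admissible layered template (spacing `a ∈ [47/50, 1]`, Hägg word `s`, heights in the
box, rigid motion `A`) matches the particles of the `R`-ball around `x i` (particles → template, tolerance `η`)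
and has all its points of norm `≤ κR` matched by particles (template → particles).  `κ = 1`: the floor's
two-way predicate `LayeredGood R η`; `κ = 0`: one-way (vacancy-blind). -/
def VacGood (κ R η : ℝ) {N : ℕ} (x : Fin N → E3) (i : Fin N) : Prop :=
  ∃ a : ℝ, 47 / 50 ≤ a ∧ a ≤ 1 ∧ ∃ (A : E3 →ₗᵢ[ℝ] E3) (s : ℤ → ℤ) (z : ℤ → ℝ), IsHaggSeq s ∧
    (∀ m : ℤ, 39 / 50 * a ≤ z (m + 1) - z m ∧ z (m + 1) - z m ≤ 17 / 20 * a) ∧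
    let S : Set E3 := {p | ∃ m k l : ℤ, p = A (((k : ℝ) • triangularVec₁ a) + ((l : ℝ) • triangularVec₂ a) +
      ((haggLabel s m : ℝ) • barlowOffset a) + (z m • layerNormal 1))}
    (∀ p ∈ S, ‖p‖ ≤ κ * R → ∃ j : Fin N, dist (x j - x i) p ≤ η) ∧
    (∀ j : Fin N, ‖x j - x i‖ ≤ R → ∃ p ∈ S, dist (x j - x i) p ≤ η)

/-- VACANCY-BLIND BUDGET with dial `κ`: at every scale `(R,η)` some `c > 0` prices the sites that are not
`κ`-good against the excess energy over `N · e(P₀)` (`κ = 1`: the floor's budget). -/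
def VacBudget (κ : ℝ) (P₀ : PeriodicConfiguration 3) : Prop :=
  ∀ R η : ℝ, 0 < R → 0 < η → ∃ c : ℝ, 0 < c ∧
    ∀ (N : ℕ) (x : Fin N → E3), IsGroundState lennardJones x →
      c * (Nat.card {i : Fin N // ¬ VacGood κ R η x i} : ℝ) ≤
        interactionEnergy lennardJones x - (N : ℝ) * P₀.energyPerParticle lennardJones

/-- Periodic windows at every scale along `x` (verbatim the conclusion of `FluxTubeKepler.PeriodicGivenLayered`). -/
def HasPeriodicWindows (x : (N : ℕ) → (Fin N → E3)) : Prop :=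
  ∃ P : PeriodicConfiguration 3, ∀ R ε : ℝ, 0 < ε → ∃ᶠ N in atTop, ∃ t : E3,
    (∀ s ∈ P.points, ‖s‖ ≤ R → ∃ i : Fin N, dist (x N i + t) s ≤ ε) ∧
    (∀ i : Fin N, ‖x N i + t‖ ≤ R → ∃ s ∈ P.points, dist (x N i + t) s ≤ ε)

/-- **The graded family.** `VacRung κ`: FLOOR and the `κ`-budget force periodic windows along every
Lennard-Jones ground-state sequence. -/
def VacRung (κ : ℝ) : Prop :=
  ∀ P₀ : PeriodicConfiguration 3, Floor P₀ → VacBudget κ P₀ →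
    ∀ x : (N : ℕ) → (Fin N → E3), (∀ N, IsGroundState lennardJones (x N)) → HasPeriodicWindows x

/-- **Deciding rung.** The budget need not price vacancies / internal voids: pricing only the sites whose
`R`-neighbourhood is not `η`-close to a SUBSET of an admissible layered template suffices. -/
def VacancyBlindRung : Prop := VacRung 0

/-! ## Predicate bookkeeping -/

theorem vacGood_anti {κ κ' R η : ℝ} (hκ : κ ≤ κ') (hR : 0 ≤ R) {N : ℕ} (x : Fin N → E3) (i : Fin N) :
    VacGood κ' R η x i → VacGood κ R η x i := by
  rintro ⟨a, ha₁, ha₂, A, s, z, hs, hz, h₁, h₂⟩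
  refine ⟨a, ha₁, ha₂, A, s, z, hs, hz, ?_, h₂⟩
  intro p hp hpR
  exact h₁ p hp (hpR.trans (mul_le_mul_of_nonneg_right hκ hR))

theorem layeredGood_of_vacGood_one {R η : ℝ} {N : ℕ} (x : Fin N → E3) (i : Fin N) :
    VacGood 1 R η x i → LayeredGood R η x i := by
  rintro ⟨a, ha₁, ha₂, A, s, z, hs, hz, h₁, h₂⟩
  refine ⟨a, ha₁, ha₂, A, s, z, hs, hz, ?_, h₂⟩
  intro p hp hpR
  exact h₁ p hp (by simpa using hpR)

theorem vacGood_one_of_layeredGood {R η : ℝ} {N : ℕ} (x : Fin N → E3) (i : Fin N) :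
    LayeredGood R η x i → VacGood 1 R η x i := by
  rintro ⟨a, ha₁, ha₂, A, s, z, hs, hz, h₁, h₂⟩
  refine ⟨a, ha₁, ha₂, A, s, z, hs, hz, ?_, h₂⟩
  intro p hp hpR
  exact h₁ p hp (by simpa using hpR)

/-- The budget is monotone in the dial: a budget pricing the larger bad set prices the smaller one. -/
theorem vacBudget_anti {κ κ' : ℝ} (hκ : κ ≤ κ') (P₀ : PeriodicConfiguration 3) :
    VacBudget κ' P₀ → VacBudget κ P₀ := by
  intro hB R η hR hη
  obtain ⟨c, hc, hcB⟩ := hB R η hR hη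
  refine ⟨c, hc, fun N x hx => le_trans ?_ (hcB N x hx)⟩
  have hle : Nat.card {i : Fin N // ¬ VacGood κ R η x i} ≤ Nat.card {i : Fin N // ¬ VacGood κ' R η x i} := by
    rw [Nat.card_eq_fintype_card, Nat.card_eq_fintype_card]
    exact Fintype.card_subtype_mono _ _ fun i hi hg => hi (vacGood_anti hκ hR.le x i hg)
  exact mul_le_mul_of_nonneg_left (by exact_mod_cast hle) hc.le

/-! ## F3 — the family specialises to the proved floor -/

/-- `VacRung 1` is the floor: the seed theorem followed by the proved `PeriodicGivenLayered`. -/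
theorem vacRung_one : VacRung 1 := by
  intro P₀ hF hB x hx
  refine Theses.FluxTubeKepler.PeriodicGivenLayered_holds x hx
    (Theorems.FluxTubeKeplerFloorGivesLayered.FloorGivesLayered_proof P₀ hF ?_ x hx)
  intro R η hR hη
  obtain ⟨c, hc, hcB⟩ := hB R η hR hη
  refine ⟨c, hc, fun N y hy => ?_⟩
  show c * (Nat.card {i : Fin N // ¬ LayeredGood R η y i} : ℝ) ≤ _
  refine le_trans ?_ (hcB N y hy)
  have hle : Nat.card {i : Fin N // ¬ LayeredGood R η y i} ≤ Nat.card {i : Fin N // ¬ VacGood 1 R η y i} := by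
    rw [Nat.card_eq_fintype_card, Nat.card_eq_fintype_card]
    exact Fintype.card_subtype_mono _ _ fun i hi hg => hi (layeredGood_of_vacGood_one y i hg)
  exact mul_le_mul_of_nonneg_left (by exact_mod_cast hle) hc.le

/-! ## Dial monotonicity (harder-to-easier = increasing `κ`) -/

theorem vacRung_mono {κ κ' : ℝ} (hκ : κ ≤ κ') : VacRung κ → VacRung κ' :=
  fun H P₀ hF hB x hx => H P₀ hF (vacBudget_anti hκ P₀ hB) x hx

/-- The deciding rung gives every member, in particular the floor (informational `specialises`). -/
theorem vacRung_of_vacancyBlindRung {κ : ℝ} (hκ : 0 ≤ κ) (h : VacancyBlindRung) : VacRung κ :=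
  vacRung_mono hκ h

/-- Honest flatness of the dial above `0`: for `κ > 0` a `κ`-good site at radius `R/κ ⊔ R` is two-way good at
radius `R`, so the `κ`-budget implies the floor's budget and `VacRung κ` is the floor again.  The step of the
ladder is exactly at `κ = 0`. -/
theorem vacRung_of_pos {κ : ℝ} (hκ : 0 < κ) : VacRung κ := by
  intro P₀ hF hB x hx
  refine Theses.FluxTubeKepler.PeriodicGivenLayered_holds x hx
    (Theorems.FluxTubeKeplerFloorGivesLayered.FloorGivesLayered_proof P₀ hF ?_ x hx)
  intro R η hR hη
  -- radius R' := max R (R / κ): κ R' ≥ R and R' ≥ R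
  obtain ⟨c, hc, hcB⟩ := hB (max R (R / κ)) η (lt_max_of_lt_left hR) hη
  refine ⟨c, hc, fun N y hy => ?_⟩
  show c * (Nat.card {i : Fin N // ¬ LayeredGood R η y i} : ℝ) ≤ _
  refine le_trans ?_ (hcB N y hy)
  have hle : Nat.card {i : Fin N // ¬ LayeredGood R η y i} ≤
      Nat.card {i : Fin N // ¬ VacGood κ (max R (R / κ)) η y i} := by
    rw [Nat.card_eq_fintype_card, Nat.card_eq_fintype_card]
    refine Fintype.card_subtype_mono _ _ fun i hi hg => hi ?_
    obtain ⟨a, ha₁, ha₂, A, s, z, hs, hz, h₁, h₂⟩ := hg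
    refine ⟨a, ha₁, ha₂, A, s, z, hs, hz, ?_, ?_⟩
    · intro p hp hpR
      refine h₁ p hp (hpR.trans ?_)
      have : R ≤ κ * (R / κ) := by rw [mul_div_cancel₀ R hκ.ne']
      exact this.trans (mul_le_mul_of_nonneg_left (le_max_right _ _) hκ.le)
    · intro j hj
      exact h₂ j (hj.trans (le_max_left _ _))
  exact mul_le_mul_of_nonneg_left (by exact_mod_cast hle) hc.le

/-! ## F4 — on-path lemmas: the sub-problem implies every member -/

theorem vacRung_of_crystallization (κ : ℝ) (h : _root_.Crystallization) : VacRung κ :=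
  fun _ _ _ x hx =>
    Theorems.ChessboardParticlePlanesPeriodicWindowsIffCrystallization.periodicWindows_of_crystallization h x hx

@[aesop safe apply]
theorem VacancyBlindRung_of_Crystallization (h : _root_.Crystallization) : VacancyBlindRung :=
  vacRung_of_crystallization 0 h

/-! ## How the rung relieves the parent crux `FluxCellKepler` (documentation, sorry-free) -/

/-- The floor-and-vacancy-blind-budget package (what a Kepler-type certificate that never has to charge a
site for MISSING neighbours delivers). -/
def VacKeplerFloor (κ : ℝ) : Prop := ∃ P₀ : PeriodicConfiguration 3, Floor P₀ ∧ VacBudget κ P₀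

theorem crystallization_of_vacRung {κ : ℝ} (h : VacRung κ) (hK : VacKeplerFloor κ) :
    _root_.Crystallization := by
  obtain ⟨P₀, hF, hB⟩ := hK
  exact Theorems.ChessboardParticlePlanesPeriodicWindowsIffCrystallization.crystallization_of_periodicWindows
    (fun x hx => h P₀ hF hB x hx)

/-- The parent crux gives the package at `κ = 1` (proved `KeplerEnergyFloor` + minimal distance). -/
theorem vacKeplerFloor_one_of_fluxCellKepler (hK : Theses.FluxTubeKepler.FluxCellKepler) : VacKeplerFloor 1 := by
  obtain ⟨P₀, hF, hB⟩ := Theorems.keplerEnergyFloor_proof hK LennardJonesMinimalDistance_holds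
  refine ⟨P₀, hF, fun R η hR hη => ?_⟩
  obtain ⟨c, hc, hcB⟩ := hB R η hR hη
  refine ⟨c, hc, fun N y hy => ?_⟩
  have hcB' : c * (Nat.card {i : Fin N // ¬ LayeredGood R η y i} : ℝ) ≤
      interactionEnergy lennardJones y - (N : ℝ) * P₀.energyPerParticle lennardJones := hcB N y hy
  refine le_trans ?_ hcB'
  have hle : Nat.card {i : Fin N // ¬ VacGood 1 R η y i} ≤ Nat.card {i : Fin N // ¬ LayeredGood R η y i} := by
    rw [Nat.card_eq_fintype_card, Nat.card_eq_fintype_card]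
    exact Fintype.card_subtype_mono _ _ fun i hi hg => hi (vacGood_one_of_layeredGood y i hg)
  exact mul_le_mul_of_nonneg_left (by exact_mod_cast hle) hc.le


/-! ## The line: vacancy sparsity from energy

Notation.  `VacGood 0 L η x i`: ONE-WAY good (the particles of the `L`-ball around `x i` are `η`-close to an
admissible layered template; nothing is asked of the template points).  A site counted in
`{i // VacGood 0 L η x i ∧ ¬ LayeredGood ρ η' x i}` (`η ≤ η'`, `ρ ≤ L`) is one-way good yet has an
`η'`-UNMATCHED template point within `ρ` — a vacancy within `ρ` (`ρ = 6/5`: a nearest-neighbour vacancy). -/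

open Summit.AtomisticToContinuum.Crystallization.Theorems.ChargedEnergyGapNegative (eStar)

/-- **VACANCY COST INEQUALITY** (the conclusion of stubs 1+2): for every target scale `(R, η')` there are a
surcharge `γ > 0`, a one-way scale `(L, η)` with `R ≤ L`, `η ≤ η'`, an accuracy `ω < γ/4` and a constant `C`
such that on every Lennard-Jones ground state the one-way-good sites with an `η'`-vacancy within `R` are priced:
`γ·#{vacancy within R} ≤ (E − N·e*) + ω·N + C·#{one-way bad}`. -/
def VacancyCost : Prop :=
  ∀ R η' : ℝ, 0 < R → 0 < η' → ∃ γ L η ω C : ℝ, 0 < γ ∧ R ≤ L ∧ 0 < η ∧ η ≤ η' ∧ 0 ≤ ω ∧ ω < γ / 4 ∧ 0 ≤ C ∧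
    ∀ (N : ℕ) (x : Fin N → E3), IsGroundState lennardJones x →
      γ * (Nat.card {i : Fin N // VacGood 0 L η x i ∧ ¬ LayeredGood R η' x i} : ℝ) ≤
        (interactionEnergy lennardJones x - (N : ℝ) * eStar) + ω * N +
          C * (Nat.card {i : Fin N // ¬ VacGood 0 L η x i} : ℝ)

/-! ### The declared stubs (the only `sorry`s of the file) -/

/-- **Stub 1 — void surface cost at the nearest-neighbour scale (THE NEW INPUT; load-bearing).**  There is a
universal surcharge `γ₀ > 0` (≈ half a nearest-neighbour bond, `½|V(a)| ≈ 0.04`) such that for every accuracy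
`ω > 0` and tolerance `η' > 0` some one-way scale `(L, η)`, `η ≤ η'`, and constant `C` give, on every Lennard-Jones
ground state, `γ₀·#{one-way (L,η)-good sites with an η'-vacancy within 6/5} ≤ (E − N·e*) + ω·N + C·#{one-way bad}`.
Intended proof: tile by cubes of side `L/2`; a cube with a one-way-good site carries ONE template `T` matching all
its particles; for its occupied template subset `O`: `Σ_{j∈cube} ½·siteE_j ≥ Σ_{p∈O} e_p(T) + ½·B(O, T∖O) − #O·ω/2`
(exact identity for template positions, all template bonds attractive, tolerance and tail errors `≤ ω/2` for `η`
small, `L` large); `½·B(O,T∖O) ≥ γ₀'·#{vacancy-adjacent occupied}`; and the layer-cake estimate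
`Σ_{p∈O} e_p(T) ≥ #O·(e* − ω/2) − (½·B(O,T∖O))/2 − C·L²` (layer energies `ε_m` of an admissible stack have every
run-average `≥ e* − C/len` by periodising the run — any periodic configuration has energy `≥ e*` — and a layer can
be cheaper than `e*` only next to a wide gap, whose omission from `O` is paid by `B`); cubes without good sites hold
only one-way-bad sites, each with `½·siteE ≥ −C₀` (`δ`-separation, `LennardJonesMinimalDistance`).  May fail if an
occupied SUBSET of a non-uniform box template can realise the first-order layer-energy variation (≈ 0.25·Δh ≤ 0.01
per site) without omitting adjacent layers — estimated safety factor ≈ 13 at the nearest-neighbour scale. [conjecture] -/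
theorem stub_voidSurfaceCost :
    ∃ γ₀ : ℝ, 0 < γ₀ ∧ ∀ ω η' : ℝ, 0 < ω → 0 < η' → ∃ L η C : ℝ, 2 ≤ L ∧ 0 < η ∧ η ≤ η' ∧ 0 ≤ C ∧
      ∀ (N : ℕ) (x : Fin N → E3), IsGroundState lennardJones x →
        γ₀ * (Nat.card {i : Fin N // VacGood 0 L η x i ∧ ¬ LayeredGood (6 / 5) η' x i} : ℝ) ≤
          (interactionEnergy lennardJones x - (N : ℝ) * eStar) + ω * N +
            C * (Nat.card {i : Fin N // ¬ VacGood 0 L η x i} : ℝ) := by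
  sorry

/-- **Stub 2 — vacancy spread (potential-free).**  For every radius `R` some `M = M(R)` bounds the number of
one-way `(L+R+3, η/2)`-good sites with an `η'`-vacancy within `R` by `M` times the number of one-way `(L, η)`-good
sites with an `η'`-vacancy within `6/5` (`η ≤ η' ≤ 1/50`), on every Lennard-Jones ground state.  Intended proof:
for such a site `i` with template `T`, every `T`-point `q` with `‖q‖ ≤ L+R+2` is either `η/2`-occupied or
`(0.91 − η/2)`-empty (template points are `≥ 0.9704·a ≥ 0.912` apart); walk a nearest-neighbour path in `T` from
`0` to the unmatched point; the last occupied point `q` before the first empty one carries a particle `j` with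
`‖x j − x i‖ ≤ R + 2`, one-way `(L, η)`-good for the RECENTRED template `T − q` (again admissible: shift of the Hägg
word and of the heights, `3·barlowOffset ∈` the triangular lattice), and NOT two-way `(6/5, η')`-good for ANY
template (a box template has 12 first-shell points at distances `∈ [0.9704a', 1.0275a'] ⊂ [0.912, 1.028]`, all to be
matched by distinct particles within `1.05` of `x j`, but the particles within `1.05` of `x j` sit on the `≤ 11`
occupied first-shell points of `q` — second shell `≥ 1.31`); finally `#{i} ≤ M·#{j}` with `M = (2(R+2)/δ+1)³` by
`δ`-separation (`squeeze_card_filter_exists_near_le`).  May fail only through tolerance bookkeeping (the constants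
`1/50`, `R+3`, `η/2` are chosen with slack). [folklore] -/
theorem stub_vacancySpread :
    ∀ R : ℝ, 0 < R → ∃ M : ℝ, 0 < M ∧ ∀ L η η' : ℝ, 0 < L → 0 < η → η ≤ η' → η' ≤ 1 / 50 →
      ∀ (N : ℕ) (x : Fin N → E3), IsGroundState lennardJones x →
        (Nat.card {i : Fin N // VacGood 0 (L + R + 3) (η / 2) x i ∧ ¬ LayeredGood R η' x i} : ℝ) ≤
          M * Nat.card {i : Fin N // VacGood 0 L η x i ∧ ¬ LayeredGood (6 / 5) η' x i} := by
  sorry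

/-- **Stub 3 — good sites from the vacancy cost (counting along ground states).**  Under FLOOR(P₀) (so
`e(P₀) = e*`, `floor_iff_eq_eStar`) and the one-way budget, the vacancy cost inequality forces, at every scale
`(R, η')`, frequently in `N`, a TWO-WAY `(R, η')`-layered-good site: by `crysEnergyLimit` the excess `E(x_N) − N·e*`
is eventually `≤ θN` for every `θ > 0`, so the one-way-bad sites are `≤ θN/c` (budget at the one-way scale) and the
sites with a vacancy within `R` are `≤ (θ + ω + Cθ/c)·N/γ < N/2` for `θ` small; any remaining site is one-way good
with no `η'`-vacancy within `R`, i.e. two-way good. [folklore] -/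
theorem stub_goodSitesOfVacancyCost :
    VacancyCost → ∀ P₀ : PeriodicConfiguration 3, Floor P₀ → VacBudget 0 P₀ →
      ∀ x : (N : ℕ) → (Fin N → E3), (∀ N, IsGroundState lennardJones (x N)) →
        ∀ R η : ℝ, 0 < R → 0 < η → ∃ᶠ N in atTop, ∃ i : Fin N, LayeredGood R η (x N) i := by
  sorry

/-! ### The stub statements as named propositions (verbatim) -/

/-- Statement of `stub_voidSurfaceCost` (verbatim). [conjecture] -/
def Sig.stub_voidSurfaceCost : Prop :=
    ∃ γ₀ : ℝ, 0 < γ₀ ∧ ∀ ω η' : ℝ, 0 < ω → 0 < η' → ∃ L η C : ℝ, 2 ≤ L ∧ 0 < η ∧ η ≤ η' ∧ 0 ≤ C ∧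
      ∀ (N : ℕ) (x : Fin N → E3), IsGroundState lennardJones x →
        γ₀ * (Nat.card {i : Fin N // VacGood 0 L η x i ∧ ¬ LayeredGood (6 / 5) η' x i} : ℝ) ≤
          (interactionEnergy lennardJones x - (N : ℝ) * eStar) + ω * N +
            C * (Nat.card {i : Fin N // ¬ VacGood 0 L η x i} : ℝ)

/-- Statement of `stub_vacancySpread` (verbatim). [folklore] -/
def Sig.stub_vacancySpread : Prop :=
    ∀ R : ℝ, 0 < R → ∃ M : ℝ, 0 < M ∧ ∀ L η η' : ℝ, 0 < L → 0 < η → η ≤ η' → η' ≤ 1 / 50 →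
      ∀ (N : ℕ) (x : Fin N → E3), IsGroundState lennardJones x →
        (Nat.card {i : Fin N // VacGood 0 (L + R + 3) (η / 2) x i ∧ ¬ LayeredGood R η' x i} : ℝ) ≤
          M * Nat.card {i : Fin N // VacGood 0 L η x i ∧ ¬ LayeredGood (6 / 5) η' x i}

/-- Statement of `stub_goodSitesOfVacancyCost` (verbatim). [folklore] -/
def Sig.stub_goodSitesOfVacancyCost : Prop :=
    VacancyCost → ∀ P₀ : PeriodicConfiguration 3, Floor P₀ → VacBudget 0 P₀ →
      ∀ x : (N : ℕ) → (Fin N → E3), (∀ N, IsGroundState lennardJones (x N)) →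
        ∀ R η : ℝ, 0 < R → 0 < η → ∃ᶠ N in atTop, ∃ i : Fin N, LayeredGood R η (x N) i

/-! ### Sorry-free glue -/

/-- One-way goodness is monotone in radius and tolerance. [folklore] -/
theorem vacGood_zero_mono {L L' η η' : ℝ} (hL : L ≤ L') (hη : η' ≤ η) {N : ℕ} (x : Fin N → E3) (i : Fin N) :
    VacGood 0 L' η' x i → VacGood 0 L η x i := by
  rintro ⟨a, ha₁, ha₂, A, s, z, hs, hz, h₁, h₂⟩
  refine ⟨a, ha₁, ha₂, A, s, z, hs, hz, ?_, ?_⟩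
  · intro p hp hpR
    obtain ⟨j, hj⟩ := h₁ p hp (by simpa using hpR)
    exact ⟨j, hj.trans hη⟩
  · intro j hj
    obtain ⟨p, hp, hjp⟩ := h₂ j (hj.trans hL)
    exact ⟨p, hp, hjp.trans hη⟩

/-- Two-way goodness is monotone in the tolerance. [folklore] -/
theorem layeredGood_mono_tol {R η η' : ℝ} (hη : η ≤ η') {N : ℕ} (x : Fin N → E3) (i : Fin N) :
    LayeredGood R η x i → LayeredGood R η' x i := by
  rintro ⟨a, ha₁, ha₂, A, s, z, hs, hz, h₁, h₂⟩
  refine ⟨a, ha₁, ha₂, A, s, z, hs, hz, ?_, ?_⟩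
  · intro p hp hpR
    obtain ⟨j, hj⟩ := h₁ p hp hpR
    exact ⟨j, hj.trans hη⟩
  · intro j hj
    obtain ⟨p, hp, hjp⟩ := h₂ j hj
    exact ⟨p, hp, hjp.trans hη⟩

/-- **Stubs 1 + 2 ⇒ the vacancy cost inequality** (constant chasing: `γ = γ₀/M(R)`, target tolerance cut at
`1/50`, one-way scale `(L+R+3, η/2)`). [folklore] -/
theorem vacancyCost_of (h₁ : Sig.stub_voidSurfaceCost) (h₂ : Sig.stub_vacancySpread) : VacancyCost := by
  intro R ηt hR hηt
  obtain ⟨γ₀, hγ₀, hcost⟩ := h₁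
  obtain ⟨M, hM, hspread⟩ := h₂ R hR
  -- target tolerance cut at 1/50
  set η' : ℝ := min ηt (1 / 50) with hη'def
  have hη'pos : 0 < η' := lt_min hηt (by norm_num)
  have hη'le : η' ≤ ηt := min_le_left _ _
  have hη'50 : η' ≤ 1 / 50 := min_le_right _ _
  set γ : ℝ := γ₀ / M with hγdef
  have hγ : 0 < γ := div_pos hγ₀ hM
  obtain ⟨L, η, C, hL, hη, hηη', hC, hineq⟩ := hcost (γ / 8) η' (by positivity) hη'pos
  have hL0 : 0 < L := by linarith
  refine ⟨γ, L + R + 3, η / 2, γ / 8, C, hγ, by linarith, by positivity,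
    by linarith [hηη'.trans hη'le], by positivity, by linarith, hC, ?_⟩
  intro N x hx
  -- (a) the target-tolerance count is below the η'-count (η' ≤ ηt)
  have hA : (Nat.card {i : Fin N // VacGood 0 (L + R + 3) (η / 2) x i ∧ ¬ LayeredGood R ηt x i} : ℝ) ≤
      Nat.card {i : Fin N // VacGood 0 (L + R + 3) (η / 2) x i ∧ ¬ LayeredGood R η' x i} := by
    have hle : Nat.card {i : Fin N // VacGood 0 (L + R + 3) (η / 2) x i ∧ ¬ LayeredGood R ηt x i} ≤
        Nat.card {i : Fin N // VacGood 0 (L + R + 3) (η / 2) x i ∧ ¬ LayeredGood R η' x i} := by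
      rw [Nat.card_eq_fintype_card, Nat.card_eq_fintype_card]
      exact Fintype.card_subtype_mono _ _ fun i hi =>
        ⟨hi.1, fun hg => hi.2 (layeredGood_mono_tol hη'le x i hg)⟩
    exact_mod_cast hle
  -- (b) spread: R-scale count ≤ M · (6/5)-scale count
  have hB := hspread L η η' hL0 hη hηη' hη'50 N x hx
  -- (c) cost at the (6/5)-scale
  have hCst := hineq N x hx
  -- (d) the one-way-bad count is monotone in the scale
  have hD : (Nat.card {i : Fin N // ¬ VacGood 0 L η x i} : ℝ) ≤
      Nat.card {i : Fin N // ¬ VacGood 0 (L + R + 3) (η / 2) x i} := by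
    have hle : Nat.card {i : Fin N // ¬ VacGood 0 L η x i} ≤
        Nat.card {i : Fin N // ¬ VacGood 0 (L + R + 3) (η / 2) x i} := by
      rw [Nat.card_eq_fintype_card, Nat.card_eq_fintype_card]
      exact Fintype.card_subtype_mono _ _ fun i hi hg =>
        hi (vacGood_zero_mono (by linarith) (by linarith) x i hg)
    exact_mod_cast hle
  have hMγ : γ * M = γ₀ := by rw [hγdef]; field_simp
  calc γ * (Nat.card {i : Fin N // VacGood 0 (L + R + 3) (η / 2) x i ∧ ¬ LayeredGood R ηt x i} : ℝ)
      ≤ γ * (M * Nat.card {i : Fin N // VacGood 0 L η x i ∧ ¬ LayeredGood (6 / 5) η' x i}) :=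
        mul_le_mul_of_nonneg_left (hA.trans hB) hγ.le
    _ = γ₀ * Nat.card {i : Fin N // VacGood 0 L η x i ∧ ¬ LayeredGood (6 / 5) η' x i} := by
        rw [← mul_assoc, hMγ]
    _ ≤ (interactionEnergy lennardJones x - (N : ℝ) * eStar) + γ / 8 * N +
          C * (Nat.card {i : Fin N // ¬ VacGood 0 L η x i} : ℝ) := hCst
    _ ≤ (interactionEnergy lennardJones x - (N : ℝ) * eStar) + γ / 8 * N +
          C * (Nat.card {i : Fin N // ¬ VacGood 0 (L + R + 3) (η / 2) x i} : ℝ) := by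
        have := mul_le_mul_of_nonneg_left hD hC
        linarith

open Summit.AtomisticToContinuum.Crystallization.Theorems.FluxTubeKeplerFloorGivesLayered
  (spacing_selection match_dilate layered_pt_scale) in
/-- (Verbatim from the sibling line `Lines/PosTolRung.lean`, ToleranceLadder.) Steps 2–3 of the seed, isolated: good sites at every scale (with scale-dependent spacings) give the
layered-windows hypothesis of `FluxTubeKepler.PeriodicGivenLayered` (one spacing by `spacing_selection`,
transfer by dilation `match_dilate` + `layered_pt_scale`, translation `t := −x N i`). [folklore] -/
theorem hasLayeredWindows_of_good (x : (N : ℕ) → (Fin N → E3))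
    (hgood : ∀ R η : ℝ, 0 < R → 0 < η → ∃ᶠ N in atTop, ∃ i : Fin N, LayeredGood R η (x N) i) :
    ∃ a : ℝ, 47 / 50 ≤ a ∧ a ≤ 1 ∧ ∀ R ε : ℝ, 0 < ε → ∃ᶠ N in Filter.atTop,
      ∃ (A : E3 →ₗᵢ[ℝ] E3) (t : E3) (s : ℤ → ℤ) (z : ℤ → ℝ), IsHaggSeq s ∧
      (∀ m : ℤ, 39 / 50 * a ≤ z (m + 1) - z m ∧ z (m + 1) - z m ≤ 17 / 20 * a) ∧
      let S : Set E3 := {p | ∃ m i j : ℤ, p = A (((i : ℝ) • triangularVec₁ a) +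
        ((j : ℝ) • triangularVec₂ a) + ((haggLabel s m : ℝ) • barlowOffset a) + (z m • layerNormal 1))};
      (∀ p ∈ S, ‖p‖ ≤ R → ∃ i : Fin N, dist (x N i + t) p ≤ ε) ∧
      (∀ i : Fin N, ‖x N i + t‖ ≤ R → ∃ p ∈ S, dist (x N i + t) p ≤ ε) := by
  -- Step 2: one spacing for all scales, the transfer being dilation of the whole layered datum
  have hgood' : ∀ R η : ℝ, 0 < R → 0 < η → ∃ᶠ N in atTop, ∃ i : Fin N, ∃ a : ℝ, 47 / 50 ≤ a ∧ a ≤ 1 ∧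
      ∃ (A : E3 →ₗᵢ[ℝ] E3) (s : ℤ → ℤ) (z : ℤ → ℝ), IsHaggSeq s ∧
        (∀ m : ℤ, 39 / 50 * a ≤ z (m + 1) - z m ∧ z (m + 1) - z m ≤ 17 / 20 * a) ∧
        let S : Set E3 := {p | ∃ m k l : ℤ, p = A (((k : ℝ) • triangularVec₁ a) +
          ((l : ℝ) • triangularVec₂ a) + ((haggLabel s m : ℝ) • barlowOffset a) + (z m • layerNormal 1))};
        (∀ p ∈ S, ‖p‖ ≤ R → ∃ j : Fin N, dist (x N j - x N i) p ≤ η) ∧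
        (∀ j : Fin N, ‖x N j - x N i‖ ≤ R → ∃ p ∈ S, dist (x N j - x N i) p ≤ η) := hgood
  obtain ⟨a, ha1, ha2, hwin⟩ := spacing_selection hgood' fun R ε hR hε => by
    obtain ⟨η₁, hη₁0, hη₁ε, hη₁1⟩ : ∃ η₁ : ℝ, 0 < η₁ ∧ η₁ ≤ ε ∧ η₁ ≤ 1 :=
      ⟨min ε 1, lt_min hε one_pos, min_le_left _ _, min_le_right _ _⟩
    have hR1 : 0 < R + 1 := by linarith
    obtain ⟨θ, hθ0, hθR⟩ : ∃ θ : ℝ, 0 < θ ∧ θ * (R + 1) = η₁ / 2 :=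
      ⟨η₁ / 2 / (R + 1), by positivity, by field_simp⟩
    refine ⟨47 / 50 * θ, by positivity, R + 1, η₁ / 2, by positivity, ?_⟩
    intro a b R' η' ha hb hab hRR' hη' N i hG
    obtain ⟨A, s, z, hs, hbox, hM₁, hM₂⟩ := hG
    have ha0 : 0 < a := by linarith
    have hb0 : 0 < b := by linarith
    obtain ⟨ρ, hρ0, hρb⟩ : ∃ ρ : ℝ, 0 < ρ ∧ ρ * b = a :=
      ⟨a / b, div_pos ha0 hb0, div_mul_cancel₀ a hb0.ne'⟩
    have habs : |b - a| < 47 / 50 * θ := hab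
    have h1ρ : |1 - ρ| ≤ θ := by
      have e1 : 1 - ρ = (b - a) / b := by rw [← hρb]; field_simp
      rw [e1, abs_div, abs_of_pos hb0, div_le_iff₀ hb0]
      nlinarith [abs_nonneg (b - a)]
    have h1ρ' : |ρ⁻¹ - 1| ≤ θ := by
      have e1 : ρ⁻¹ - 1 = (b - a) / a := by rw [← hρb]; field_simp
      rw [e1, abs_div, abs_of_pos ha0, div_le_iff₀ ha0]
      nlinarith [abs_nonneg (b - a)]
    refine ⟨A, s, fun m => ρ * z m, hs, fun m => ?_, ?_⟩
    · obtain ⟨hl, hu⟩ := hbox m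
      have hl' := mul_le_mul_of_nonneg_left hl hρ0.le
      have hu' := mul_le_mul_of_nonneg_left hu hρ0.le
      constructor
      · calc 39 / 50 * a = ρ * (39 / 50 * b) := by rw [← hρb]; ring
          _ ≤ ρ * (z (m + 1) - z m) := hl'
          _ = ρ * z (m + 1) - ρ * z m := by ring
      · calc ρ * z (m + 1) - ρ * z m = ρ * (z (m + 1) - z m) := by ring
          _ ≤ ρ * (17 / 20 * b) := hu'
          _ = 17 / 20 * a := by rw [← hρb]; ring
    · have hscale : ∀ m k l : ℤ, A (((k : ℝ) • triangularVec₁ a) + ((l : ℝ) • triangularVec₂ a) +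
          ((haggLabel s m : ℝ) • barlowOffset a) + ((ρ * z m) • layerNormal 1)) =
          ρ • A (((k : ℝ) • triangularVec₁ b) + ((l : ℝ) • triangularVec₂ b) +
          ((haggLabel s m : ℝ) • barlowOffset b) + (z m • layerNormal 1)) := by
        intro m k l
        rw [← hρb]
        exact layered_pt_scale A ρ b s z m k l
      dsimp only
      refine match_dilate (fun j => x N j - x N i) _ _ hθ0 hθR hη₁ε hη₁1 hρ0 h1ρ h1ρ' hRR' hη'
        ?_ ?_ hM₁ hM₂
      · rintro p ⟨m, k, l, rfl⟩
        exact ⟨m, k, l, (hscale m k l).symm⟩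
      · rintro p' ⟨m, k, l, rfl⟩
        exact ⟨_, ⟨m, k, l, rfl⟩, hscale m k l⟩
  -- Step 3: read the fixed-spacing good site at radius `max R 1` and translate by `t := -x N i`
  refine ⟨a, ha1, ha2, fun R ε hε => ?_⟩
  have hR' : 0 < max R 1 := lt_max_of_lt_right one_pos
  refine (hwin (max R 1) ε hR' hε).mono fun N hN => ?_
  obtain ⟨i, hi⟩ := hN
  obtain ⟨A, s, z, hs, hbox, hM₁, hM₂⟩ := hi
  refine ⟨A, -x N i, s, z, hs, hbox, ?_⟩
  have hsub : ∀ j : Fin N, x N j + -x N i = x N j - x N i := fun j =>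
    (sub_eq_add_neg (x N j) (x N i)).symm
  intro S
  refine ⟨fun p hp hpR => ?_, fun j hj => ?_⟩
  · obtain ⟨j, hj⟩ := hM₁ p hp (hpR.trans (le_max_left R 1))
    exact ⟨j, by rw [hsub j]; exact hj⟩
  · rw [hsub j] at hj ⊢
    exact hM₂ j (hj.trans (le_max_left R 1))



/-! ### The skeleton theorem: the rung BY NAME from the three stub statements (sorry-free) -/

/-- **Assembly.** `stub_voidSurfaceCost → stub_vacancySpread → stub_goodSitesOfVacancyCost → VacancyBlindRung`:
stubs 1+2 give the vacancy cost inequality (`vacancyCost_of`); with FLOOR and the one-way budget, stub 3 turns it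
into two-way good sites at every scale, hence layered windows (`hasLayeredWindows_of_good`) and periodic windows
(proved `PeriodicGivenLayered`). -/
theorem VacancyBlindRung_of (h₁ : Sig.stub_voidSurfaceCost) (h₂ : Sig.stub_vacancySpread)
    (h₃ : Sig.stub_goodSitesOfVacancyCost) : VacancyBlindRung := by
  intro P₀ hF hB x hx
  have hgood := h₃ (vacancyCost_of h₁ h₂) P₀ hF hB x hx
  exact Theses.FluxTubeKepler.PeriodicGivenLayered_holds x hx (hasLayeredWindows_of_good x hgood)

/-- **The closed skeleton instance**: the rung by name from the three declared stubs (the only `sorry`s of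
this file enter here). [conjecture] -/
theorem VacancyBlindRung_skeleton : VacancyBlindRung :=
  VacancyBlindRung_of stub_voidSurfaceCost stub_vacancySpread stub_goodSitesOfVacancyCost

end Summit.AtomisticToContinuum.Crystallization.Cruxes.FluxCellKepler.VacancyLadder

end
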